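import Summits.HubbardSuperconductivity.HubbardSuperconductivity.Theorems.BalabanIRBirEveryGroundStateSpectralCurve
import Mathlib.RingTheory.Polynomial.UniqueFactorization
import Mathlib.RingTheory.UniqueFactorizationDomain.Multiplicity
import Mathlib.FieldTheory.IsAlgClosed.Basic
import Mathlib.Algebra.Order.Group.Finset

/-!
# Route `BalabanIR`, crux 5 `BirEveryGroundState` (`stmt-HubbardSuperconductivity-2083`):
# anchor transfer AT A NON-EXCEPTIONAL COUPLING (line `spectral-curve-anchor`, stub 2)

Theses-free (rev-5 materialisation rule; imports only the spectral-curve toolkit, which imports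
no route file). Registered stub `stub_anchorTransferNonexceptional` of the crux-plan skeleton
`Lines/spectral-curve-anchor.lean` (2026-08-16), proved verbatim:

for `Φ` monic in `ℂ[U][X]`, `χ ∣ Φ` monic, `p` an irreducible factor of `χ` carrying an ANCHOR
(at one complex coupling some root of `p(U₀, ·)` is a simple root of `χ(U₀, ·)`), and a REAL
coupling `U` at which the number of distinct roots of `Φ(U, ·)` is maximal among real couplings
(a non-exceptional coupling, as produced by `exists_coupling_forall_card_roots_le_hubbardTorus`),
EVERY root of `p(U, ·)` is a simple root of `χ(U, ·)`.

Proof ("the generic number of distinct roots is attained exactly off the exceptional set"):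
* `genericCount` — for `F ∈ ℂ[U][X]` with unit leading coefficient there is `N` with
  `#roots F(u, ·) ≤ N` for all `u ∈ ℂ` and equality off a FINITE set (strong induction on the
  degree: split off the maximal power `p^e` of an irreducible factor, `F = p^e Q`, `p ∤ Q`; by
  Gauss's lemma `p` is coprime over `ℂ(U)` to `∂p/∂X` and to `Q`, so off finitely many couplings
  (`finite_setOf_exists_common_root`) `p(u, ·)` has `deg p` simple roots, none shared with
  `Q(u, ·)`, and `#roots F(u, ·) = deg p + #roots Q(u, ·)`).
* at a real maximiser `U` (compare with a good real coupling, which exists since the bad set is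
  finite and `ℝ` is not): `p(U, ·)` has `deg p` distinct roots — all simple — and shares none with
  `Q(U, ·)`; the anchor gives `χ = p r` with `p ∤ r`, unique factorisation gives `r ∣ Q`, so a root
  of `p(U, ·)` is no root of `r(U, ·)` and has multiplicity `1 + 0` in `χ(U, ·)`.

Kato, *Perturbation Theory for Linear Operators* (1966) II §1.1 (finitely many exceptional
points of an algebraic family); Gauss's lemma. Folklore algebra; no definition is introduced.
-/

noncomputable section

namespace Summit.HubbardSuperconductivity.HubbardSuperconductivity.Theorems

open Polynomial
open scoped Polynomial

section GenericCount

/-- A polynomial over `ℂ[U]` with UNIT leading coefficient keeps its degree, and stays non-zero,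
under every specialisation `U ↦ u` (units of `ℂ[U]` are the non-zero constants). [folklore] -/
theorem natDegree_map_evalRingHom_of_isUnit {F : ℂ[X][X]} (hF : IsUnit F.leadingCoeff) (u : ℂ) :
    (F.map (evalRingHom u)).natDegree = F.natDegree ∧ F.map (evalRingHom u) ≠ 0 := by
  obtain ⟨c, hc, hcF⟩ := Polynomial.isUnit_iff.mp hF
  have hne : (evalRingHom u) F.leadingCoeff ≠ 0 := by
    rw [← hcF, coe_evalRingHom, eval_C]
    exact hc.ne_zero
  refine ⟨natDegree_map_of_leadingCoeff_ne_zero _ hne, fun h0 => ?_⟩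
  have h := leadingCoeff_map_of_leadingCoeff_ne_zero _ hne
  rw [h0, leadingCoeff_zero] at h
  exact hne h.symm

/-- A divisor of a polynomial with unit leading coefficient has unit leading coefficient.
[folklore] -/
theorem isUnit_leadingCoeff_of_dvd {F G : ℂ[X][X]} (hG : IsUnit G.leadingCoeff) (h : F ∣ G) :
    IsUnit F.leadingCoeff := by
  obtain ⟨s, rfl⟩ := h
  rw [leadingCoeff_mul] at hG
  exact isUnit_of_mul_isUnit_left hG

/-- The number of distinct roots of a specialisation is at most the degree. [folklore] -/
theorem card_roots_toFinset_map_le (F : ℂ[X][X]) (u : ℂ) :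
    (F.map (evalRingHom u)).roots.toFinset.card ≤ F.natDegree :=
  (Multiset.toFinset_card_le _).trans ((card_roots' _).trans natDegree_map_le)

/-- A non-zero complex polynomial none of whose roots is a root of its derivative has exactly
`natDegree` distinct roots. [folklore] -/
theorem card_roots_toFinset_eq_natDegree {f : ℂ[X]} (hf : f ≠ 0)
    (h : ∀ μ : ℂ, f.IsRoot μ → ¬ (derivative f).IsRoot μ) :
    f.roots.toFinset.card = f.natDegree := by
  classical
  have hnodup : f.roots.Nodup := by
    rw [Multiset.nodup_iff_count_le_one]
    intro μ
    rw [count_roots]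
    by_contra hlt
    have h2 := (one_lt_rootMultiplicity_iff_isRoot (t := μ) hf).mp (by omega)
    exact h μ h2.1 h2.2
  rw [Multiset.toFinset_card_of_nodup hnodup, IsAlgClosed.card_roots_eq_natDegree]

/-- Conversely, a non-zero complex polynomial with `natDegree` distinct roots has only simple
roots. [folklore] -/
theorem rootMultiplicity_eq_one_of_card_roots_toFinset {f : ℂ[X]} (hf : f ≠ 0)
    (h : f.roots.toFinset.card = f.natDegree) {μ : ℂ} (hμ : f.IsRoot μ) :
    f.rootMultiplicity μ = 1 := by
  classical
  have hnodup : f.roots.Nodup :=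
    Multiset.toFinset_card_eq_card_iff_nodup.mp (by rw [h, IsAlgClosed.card_roots_eq_natDegree])
  rw [← count_roots, Multiset.count_eq_one_of_mem hnodup ((mem_roots hf).mpr hμ)]

/-- The distinct roots of `f ^ e * g` (`e ≥ 1`) are those of `f` together with those of `g`.
[folklore] -/
theorem roots_toFinset_pow_mul {f g : ℂ[X]} (hf : f ≠ 0) (hg : g ≠ 0) {e : ℕ} (he : e ≠ 0) :
    (f ^ e * g).roots.toFinset = f.roots.toFinset ∪ g.roots.toFinset := by
  classical
  rw [roots_mul (mul_ne_zero (pow_ne_zero _ hf) hg), roots_pow, Multiset.toFinset_add,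
    Multiset.toFinset_nsmul _ _ he]

/-- **An irreducible factor is generically simple and generically prime to its cofactor.** If
`F = p ^ e * Q` in `ℂ[U][X]` with `F` of unit leading coefficient, `p` irreducible, `p ∤ Q` and
`e ≥ 1`, then `p` and `Q` have unit leading coefficients, `0 < deg p`, `deg Q < deg F`, and the
set of couplings `u` at which some root of `p(u, ·)` is a root of `∂p/∂X (u, ·)` or of `Q(u, ·)`
is FINITE (`p` is primitive; Gauss's lemma makes it irreducible over `ℂ(U)`, hence coprime there
to its `X`-derivative and to `Q`; `finite_setOf_exists_common_root`). [folklore] -/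
theorem irreducible_factor_finite_bad {F p Q : ℂ[X][X]} (hF : IsUnit F.leadingCoeff)
    (hp : Irreducible p) {e : ℕ} (hFpQ : F = p ^ e * Q) (hpQ : ¬ p ∣ Q) (he : e ≠ 0) :
    IsUnit p.leadingCoeff ∧ IsUnit Q.leadingCoeff ∧ 0 < p.natDegree ∧
      Q.natDegree < F.natDegree ∧
      Set.Finite {u : ℂ | ∃ μ : ℂ, (p.map (evalRingHom u)).IsRoot μ ∧
        ((derivative (p.map (evalRingHom u))).IsRoot μ ∨ (Q.map (evalRingHom u)).IsRoot μ)} := by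
  classical
  have hpd : p ∣ F := ⟨p ^ (e - 1) * Q, by
    rw [hFpQ, ← mul_assoc, ← pow_succ', Nat.sub_add_cancel (Nat.pos_of_ne_zero he)]⟩
  have hQd : Q ∣ F := ⟨p ^ e, by rw [hFpQ, mul_comm]⟩
  have hlp := isUnit_leadingCoeff_of_dvd hF hpd
  have hlQ := isUnit_leadingCoeff_of_dvd hF hQd
  have hdeg : 0 < p.natDegree := by
    rw [Nat.pos_iff_ne_zero]
    intro h0
    apply hp.not_isUnit
    rw [eq_C_of_natDegree_eq_zero h0]
    refine isUnit_C.mpr ?_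
    have h1 : p.leadingCoeff = p.coeff 0 := by rw [leadingCoeff, h0]
    rw [← h1]
    exact hlp
  have hF0 : F ≠ 0 := fun h => by
    rw [h, leadingCoeff_zero] at hF
    exact not_isUnit_zero hF
  have hp0 : p ≠ 0 := hp.ne_zero
  have hQ0 : Q ≠ 0 := by
    rintro rfl
    rw [mul_zero] at hFpQ
    exact hF0 hFpQ
  have hdegQ : Q.natDegree < F.natDegree := by
    rw [hFpQ, natDegree_mul (pow_ne_zero _ hp0) hQ0, natDegree_pow]
    have : 0 < e * p.natDegree := Nat.mul_pos (Nat.pos_of_ne_zero he) hdeg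
    omega
  -- primitivity (the leading coefficient is a unit) and Gauss's lemma
  have hprim : p.IsPrimitive := by
    rw [isPrimitive_iff_isUnit_of_C_dvd]
    rintro r ⟨s, hs⟩
    refine isUnit_of_dvd_unit ⟨s.leadingCoeff, ?_⟩ hlp
    rw [hs, leadingCoeff_mul, leadingCoeff_C]
  set φ : ℂ[X] →+* RatFunc ℂ := algebraMap ℂ[X] (RatFunc ℂ) with hφ
  have hφinj : Function.Injective φ := IsFractionRing.injective ℂ[X] (RatFunc ℂ)
  have hirrK : Irreducible (p.map φ) := (hprim.irreducible_iff_irreducible_map_fraction_map).mp hp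
  have hcopQ : IsCoprime (p.map φ) (Q.map φ) := by
    refine hirrK.coprime_iff_not_dvd.mpr fun hK' => hpQ ?_
    exact (hprim.dvd_iff_fraction_map_dvd_fraction_map (RatFunc ℂ)).mpr hK'
  have hdegK : (p.map φ).natDegree = p.natDegree := natDegree_map_eq_of_injective hφinj p
  have hcopd : IsCoprime (p.map φ) ((derivative p).map φ) := by
    rw [← derivative_map]
    refine hirrK.coprime_iff_not_dvd.mpr fun hK' => ?_
    have hd0 : derivative (p.map φ) ≠ 0 := by
      intro h0
      have := Polynomial.derivative_eq_zero.mp h0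
      omega
    have hle := natDegree_le_of_dvd hK' hd0
    have hlt := natDegree_derivative_lt (p := p.map φ) (by omega)
    omega
  have hS₁ := finite_setOf_exists_common_root hcopd
  have hS₂ := finite_setOf_exists_common_root hcopQ
  refine ⟨hlp, hlQ, hdeg, hdegQ, (hS₁.union hS₂).subset ?_⟩
  rintro u ⟨μ, hpu, h | h⟩
  · left
    refine ⟨μ, hpu, ?_⟩
    rwa [derivative_map] at h
  · right
    exact ⟨μ, hpu, h⟩

/-- **The generic number of distinct roots.** For `F ∈ ℂ[U][X]` with unit leading coefficient
there is `N` such that every specialisation `F(u, ·)` has at most `N` distinct roots and has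
EXACTLY `N` off a finite set of couplings `u`. (Strong induction on `deg F` via
`irreducible_factor_finite_bad`: `N(F) = deg p + N(Q)` for `F = p^e Q`.) Kato (1966) II §1.1.
[folklore] -/
theorem genericCount : ∀ (d : ℕ) (F : ℂ[X][X]), F.natDegree = d → IsUnit F.leadingCoeff →
    ∃ N : ℕ, (∀ u : ℂ, (F.map (evalRingHom u)).roots.toFinset.card ≤ N) ∧
      Set.Finite {u : ℂ | (F.map (evalRingHom u)).roots.toFinset.card < N} := by
  intro d
  induction d using Nat.strong_induction_on with
  | _ d ih => ?_
  intro F hFd hF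
  classical
  by_cases hunit : IsUnit F
  · -- a unit is a non-zero constant: no roots anywhere
    refine ⟨0, fun u => ?_, ?_⟩
    · obtain ⟨c, hc, hcF⟩ := Polynomial.isUnit_iff.mp hunit
      obtain ⟨c₀, -, hc₀c⟩ := Polynomial.isUnit_iff.mp hc
      rw [← hcF, map_C, coe_evalRingHom, ← hc₀c, eval_C, roots_C]
      simp
    · simp
  · have hF0 : F ≠ 0 := fun h => by
      rw [h, leadingCoeff_zero] at hF
      exact not_isUnit_zero hF
    obtain ⟨p, hp, hpF⟩ := WfDvdMonoid.exists_irreducible_factor hunit hF0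
    obtain ⟨e, Q, hpQ, hFpQ⟩ := WfDvdMonoid.max_power_factor hF0 hp
    have he : e ≠ 0 := by
      rintro rfl
      rw [pow_zero, one_mul] at hFpQ
      exact hpQ (hFpQ ▸ hpF)
    obtain ⟨hlp, hlQ, -, hdegQ, hbad⟩ := irreducible_factor_finite_bad hF hp hFpQ hpQ he
    obtain ⟨NQ, hNQ, hbadQ⟩ := ih Q.natDegree (hFd ▸ hdegQ) Q rfl hlQ
    have hsplit : ∀ u : ℂ, (F.map (evalRingHom u)).roots.toFinset =
        (p.map (evalRingHom u)).roots.toFinset ∪ (Q.map (evalRingHom u)).roots.toFinset := by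
      intro u
      rw [hFpQ, Polynomial.map_mul, Polynomial.map_pow]
      exact roots_toFinset_pow_mul (natDegree_map_evalRingHom_of_isUnit hlp u).2
        (natDegree_map_evalRingHom_of_isUnit hlQ u).2 he
    refine ⟨p.natDegree + NQ, fun u => ?_, ?_⟩
    · rw [hsplit u]
      exact (Finset.card_union_le _ _).trans
        (add_le_add (card_roots_toFinset_map_le p u) (hNQ u))
    · refine (hbad.union hbadQ).subset fun u hu => ?_
      by_contra hnot
      rw [Set.mem_union, not_or] at hnot
      obtain ⟨h1, h2⟩ := hnot
      simp only [Set.mem_setOf_eq, not_exists, not_and, not_or] at h1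
      simp only [Set.mem_setOf_eq, not_lt] at h2
      obtain ⟨hdp, hp0⟩ := natDegree_map_evalRingHom_of_isUnit hlp u
      have ha : (p.map (evalRingHom u)).roots.toFinset.card = p.natDegree := by
        rw [← hdp]
        exact card_roots_toFinset_eq_natDegree hp0 fun μ hμ hd => (h1 μ hμ).1 hd
      have hdisj : Disjoint (p.map (evalRingHom u)).roots.toFinset
          (Q.map (evalRingHom u)).roots.toFinset := by
        rw [Finset.disjoint_left]
        intro μ hμp hμQ
        rw [Multiset.mem_toFinset, mem_roots hp0] at hμp
        rw [Multiset.mem_toFinset, mem_roots (natDegree_map_evalRingHom_of_isUnit hlQ u).2] at hμQ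
        exact (h1 μ hμp).2 hμQ
      have hcard : (F.map (evalRingHom u)).roots.toFinset.card =
          p.natDegree + (Q.map (evalRingHom u)).roots.toFinset.card := by
        rw [hsplit u, Finset.card_union_of_disjoint hdisj, ha]
      simp only [Set.mem_setOf_eq] at hu
      omega

end GenericCount

section Stub

/-- **Registered stub `stub_anchorTransferNonexceptional`** (line `spectral-curve-anchor` of
crux `BirEveryGroundState`): for `Φ` monic in `ℂ[U][X]`, a monic `χ ∣ Φ`, an irreducible
`p ∣ χ` carrying an ANCHOR (at one complex coupling some root of `p(U₀, ·)` is a simple root of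
`χ(U₀, ·)`), and a REAL coupling `U` maximising the number of distinct roots of `Φ(u', ·)` over
real `u'` (a non-exceptional coupling), every root of `p(U, ·)` is a SIMPLE root of `χ(U, ·)`.
Proof: `Φ = p^e Q` with `p ∤ Q`; by `genericCount` for `Q` and `irreducible_factor_finite_bad`
there is a real coupling `u₁` at which `p(u₁, ·)` has `deg p` simple roots, none a root of
`Q(u₁, ·)`, and `Q(u₁, ·)` has its generic number of roots; maximality at `U` then forces the
same at `U` (counting `#(A ∪ B) + #(A ∩ B) = #A + #B`); the anchor gives `χ = p r` with `p ∤ r`,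
so `r ∣ Q` (unique factorisation), a root of `p(U, ·)` is not a root of `r(U, ·)`, and its
multiplicity in `χ(U, ·) = p(U, ·) r(U, ·)` is `1 + 0`. Kato (1966) II §1.1; Gauss's lemma.
[folklore] -/
theorem stub_anchorTransferNonexceptional (χ Φ p : ℂ[X][X]) (hχ : χ.Monic) (hΦ : Φ.Monic) (hχΦ : χ ∣ Φ) (hp : Irreducible p) (hpχ : p ∣ χ) (hanchor : ∃ U₀ μ₀ : ℂ, (p.map (evalRingHom U₀)).IsRoot μ₀ ∧ (χ.map (evalRingHom U₀)).rootMultiplicity μ₀ = 1) (U : ℝ) (hmax : ∀ u' : ℝ, (Φ.map (evalRingHom ((u' : ℝ) : ℂ))).roots.toFinset.card ≤ (Φ.map (evalRingHom (U : ℂ))).roots.toFinset.card) : ∀ μ : ℂ, (p.map (evalRingHom (U : ℂ))).IsRoot μ → (χ.map (evalRingHom (U : ℂ))).rootMultiplicity μ = 1 := by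
  classical
  intro μ hμ
  have hΦu : IsUnit Φ.leadingCoeff := by rw [hΦ.leadingCoeff]; exact isUnit_one
  obtain ⟨e, Q, hpQ, hΦpQ⟩ := WfDvdMonoid.max_power_factor hΦ.ne_zero hp
  have hpΦ : p ∣ Φ := hpχ.trans hχΦ
  have he : e ≠ 0 := by
    rintro rfl
    rw [pow_zero, one_mul] at hΦpQ
    exact hpQ (hΦpQ ▸ hpΦ)
  obtain ⟨hlp, hlQ, -, -, hbad⟩ := irreducible_factor_finite_bad hΦu hp hΦpQ hpQ he
  obtain ⟨NQ, hNQ, hbadQ⟩ := genericCount Q.natDegree Q rfl hlQ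
  have hp0 : ∀ u : ℂ, p.map (evalRingHom u) ≠ 0 := fun u =>
    (natDegree_map_evalRingHom_of_isUnit hlp u).2
  have hQ0 : ∀ u : ℂ, Q.map (evalRingHom u) ≠ 0 := fun u =>
    (natDegree_map_evalRingHom_of_isUnit hlQ u).2
  have hsplit : ∀ u : ℂ, (Φ.map (evalRingHom u)).roots.toFinset =
      (p.map (evalRingHom u)).roots.toFinset ∪ (Q.map (evalRingHom u)).roots.toFinset := by
    intro u
    rw [hΦpQ, Polynomial.map_mul, Polynomial.map_pow]
    exact roots_toFinset_pow_mul (hp0 u) (hQ0 u) he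
  -- a good REAL coupling `u₁`: off both finite bad sets
  obtain ⟨u₁, hu₁⟩ : ∃ u₁ : ℝ, ((u₁ : ℂ) ∉ {u : ℂ | ∃ μ : ℂ, (p.map (evalRingHom u)).IsRoot μ ∧
      ((derivative (p.map (evalRingHom u))).IsRoot μ ∨ (Q.map (evalRingHom u)).IsRoot μ)}) ∧
      ((u₁ : ℂ) ∉ {u : ℂ | (Q.map (evalRingHom u)).roots.toFinset.card < NQ}) := by
    have hfin := (hbad.union hbadQ).preimage Complex.ofReal_injective.injOn
    obtain ⟨u₁, hu₁⟩ := hfin.infinite_compl.nonempty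
    rw [Set.mem_compl_iff, Set.mem_preimage, Set.mem_union, not_or] at hu₁
    exact ⟨u₁, hu₁⟩
  obtain ⟨h1, h2⟩ := hu₁
  simp only [Set.mem_setOf_eq, not_exists, not_and, not_or] at h1
  simp only [Set.mem_setOf_eq, not_lt] at h2
  -- counts at `u₁`
  have ha₁ : (p.map (evalRingHom (u₁ : ℂ))).roots.toFinset.card = p.natDegree := by
    rw [← (natDegree_map_evalRingHom_of_isUnit hlp (u₁ : ℂ)).1]
    exact card_roots_toFinset_eq_natDegree (hp0 _) fun ν hν hd => (h1 ν hν).1 hd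
  have hdisj₁ : Disjoint (p.map (evalRingHom (u₁ : ℂ))).roots.toFinset
      (Q.map (evalRingHom (u₁ : ℂ))).roots.toFinset := by
    rw [Finset.disjoint_left]
    intro ν hνp hνQ
    rw [Multiset.mem_toFinset, mem_roots (hp0 _)] at hνp
    rw [Multiset.mem_toFinset, mem_roots (hQ0 _)] at hνQ
    exact (h1 ν hνp).2 hνQ
  have hn₁ : (Φ.map (evalRingHom (u₁ : ℂ))).roots.toFinset.card =
      p.natDegree + (Q.map (evalRingHom (u₁ : ℂ))).roots.toFinset.card := by
    rw [hsplit, Finset.card_union_of_disjoint hdisj₁, ha₁]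
  -- counts at `U`
  have hU := Finset.card_union_add_card_inter (p.map (evalRingHom (U : ℂ))).roots.toFinset
    (Q.map (evalRingHom (U : ℂ))).roots.toFinset
  rw [← hsplit] at hU
  have haU := card_roots_toFinset_map_le p (U : ℂ)
  have hbU := hNQ (U : ℂ)
  have hmax₁ := hmax u₁
  have hinter : ((p.map (evalRingHom (U : ℂ))).roots.toFinset ∩
      (Q.map (evalRingHom (U : ℂ))).roots.toFinset).card = 0 := by omega
  have haU' : (p.map (evalRingHom (U : ℂ))).roots.toFinset.card = p.natDegree := by omega
  -- every root of `p(U, ·)` is simple ...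
  have hmultp : (p.map (evalRingHom (U : ℂ))).rootMultiplicity μ = 1 :=
    rootMultiplicity_eq_one_of_card_roots_toFinset (hp0 _)
      (haU'.trans (natDegree_map_evalRingHom_of_isUnit hlp (U : ℂ)).1.symm) hμ
  -- ... and is no root of `Q(U, ·)`
  have hμQ : ¬ (Q.map (evalRingHom (U : ℂ))).IsRoot μ := by
    intro hQμ
    rw [Finset.card_eq_zero] at hinter
    have hmem : μ ∈ (p.map (evalRingHom (U : ℂ))).roots.toFinset ∩
        (Q.map (evalRingHom (U : ℂ))).roots.toFinset := by
      rw [Finset.mem_inter, Multiset.mem_toFinset, mem_roots (hp0 _), Multiset.mem_toFinset,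
        mem_roots (hQ0 _)]
      exact ⟨hμ, hQμ⟩
    rw [hinter] at hmem
    exact Finset.notMem_empty μ hmem
  -- the anchor: `χ = p r` with `p ∤ r`
  obtain ⟨r, hr⟩ := hpχ
  have hχU : ∀ u : ℂ, χ.map (evalRingHom u) ≠ 0 := fun u => (hχ.map _).ne_zero
  have hndvd : ¬ p ∣ r := by
    rintro ⟨s, hs⟩
    obtain ⟨U₀, μ₀, hroot, hmult⟩ := hanchor
    have hfac : χ.map (evalRingHom U₀) =
        p.map (evalRingHom U₀) * (p.map (evalRingHom U₀) * s.map (evalRingHom U₀)) := by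
      rw [hr, hs, Polynomial.map_mul, Polynomial.map_mul]
    have hne : p.map (evalRingHom U₀) * (p.map (evalRingHom U₀) * s.map (evalRingHom U₀)) ≠ 0 :=
      hfac ▸ hχU U₀
    have hpos : 0 < (p.map (evalRingHom U₀)).rootMultiplicity μ₀ :=
      (rootMultiplicity_pos (hp0 U₀)).mpr hroot
    rw [hfac, rootMultiplicity_mul hne, rootMultiplicity_mul (right_ne_zero_of_mul hne)] at hmult
    omega
  -- unique factorisation: `r ∣ Q`
  have hr0 : r ≠ 0 := by
    rintro rfl
    rw [mul_zero] at hr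
    exact hχ.ne_zero hr
  have hrQ : r ∣ Q := by
    have h1 : p * r ∣ p * (p ^ (e - 1) * Q) := by
      rw [← hr, ← mul_assoc, ← pow_succ', Nat.sub_add_cancel (Nat.pos_of_ne_zero he), ← hΦpQ]
      exact hχΦ
    rw [mul_dvd_mul_iff_left hp.ne_zero, mul_comm] at h1
    refine UniqueFactorizationMonoid.dvd_of_dvd_mul_left_of_no_prime_factors hr0 ?_ h1
    intro d hdr hdp hprime
    have hdp' : d ∣ p := hprime.dvd_of_dvd_pow hdp
    have hassoc : Associated d p := hprime.irreducible.associated_of_dvd hp hdp'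
    exact hndvd (hassoc.symm.dvd.trans hdr)
  have hμr : ¬ (r.map (evalRingHom (U : ℂ))).IsRoot μ := fun h =>
    hμQ (h.dvd (Polynomial.map_dvd (evalRingHom (U : ℂ)) hrQ))
  have hne : p.map (evalRingHom (U : ℂ)) * r.map (evalRingHom (U : ℂ)) ≠ 0 := by
    rw [← Polynomial.map_mul, ← hr]
    exact hχU _
  rw [hr, Polynomial.map_mul, rootMultiplicity_mul hne, hmultp, rootMultiplicity_eq_zero hμr]

end Stub

end Summit.HubbardSuperconductivity.HubbardSuperconductivity.Theorems
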